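import Literature.AlgebraicGeometry.Morphisms.CechH1Projective
import Mathlib.AlgebraicGeometry.Modules.Sheaf
import Mathlib.Algebra.Category.ModuleCat.Presheaf.Submodule
import HarnessLib

/-!
# Serre's twisting sheaves `𝒪_Z(-m)` of a scheme over projective space, as sheaves of modules

For a commutative ring `A`, `𝐏 = 𝐏ʳ_A = Proj A[x₀, …, x_r]` (`ProjCech.PP A r`) and a morphism of
schemes `ι : Z ⟶ 𝐏` (typically a closed immersion, or a thickening of one), this file constructs,
for every `m : ℕ`, the `𝒪_Z`-module `𝒪_Z(-m) = ι^* 𝒪_𝐏(-m)` as an object `serreTwist ι m : Z.Modules`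
of Mathlib's category of sheaves of modules, WITHOUT tensor products, gluing data or graded
modules: it is the subsheaf of the product `𝒪_Z^{W_m}`, `W_m = (Fin m → Fin (r+1))` the words of
length `m` in the variables (a word `w` names the monomial `μ_w = x_{w 0} ⋯ x_{w (m-1)}` of degree
`m`; repetitions are harmless), consisting of the families `(f_w)_w` of functions which on every
standard chart `Z_j = ι⁻¹ D₊(x_j)` are proportional to the family of degree-zero fractions
`(μ_w / x_j^m)_w`:

  `f ∈ Γ(U, 𝒪_Z(-m)) ⟺ ∀ j w w', f_w · (μ_{w'} / x_j^m) = f_{w'} · (μ_w / x_j^m)` on `U ∩ Z_j`.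

On `Z_j` it is free of rank one on the generator `v_j = (μ_w / x_j^m)_w`, with `v_j = (x_{j'}/x_j)^m v_{j'}`
on `Z_j ∩ Z_{j'}`: these are the transition functions of `𝒪(-m)` (Hartshorne II.5.12; EGA II 2.5), so
`serreTwist ι m` IS `ι^* 𝒪_𝐏(-m)`; for `m = 0` it is `𝒪_Z`. Multiplication by the variable `x_l`,
i.e. the section `x_l ∈ Γ(𝐏, 𝒪(1))`, is the morphism `𝒪_Z(-(m+1)) → 𝒪_Z(-m)`, `f ↦ (w ↦ f (l :: w))`
(`serreTwist.mulX`). Positive twists of a module `N` are then the internal Homs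
`N(m) := 𝓗om(𝒪_Z(-m), N)` (`Literature/AlgebraicGeometry/Modules/SheafHom`), which is how Serre's
theorems A and B are phrased downstream (`Modules/SerreTwistCharts`, `Modules/SerreTheoremA`, …).

Contents: the product module `piModule X I` (`U ↦ (I → Γ(X, U))`, any scheme, any index type in
`Type`), the chart functions `chartFun ι i j = x_i / x_j ∈ Γ(Z, Z_j)` and `wordFun ι j w = μ_w / x_j^m`
(through the tree's evaluation of degree-zero Laurent fractions `ProjCech.evalRing`, `LaurentCech.tElB`),
the defining relation `IsTwistSection`, the subsheaf `serreTwist ι m` with its inclusion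
`serreTwistι ι m : serreTwist ι m ⟶ piModule Z (Fin m → Fin (r + 1))`, and `mulX`. Only the
definitions and their section-level unfoldings are here; the chart trivialisations, local freeness
and the identification with `𝒪_Z` for `m = 0` are in `Modules/SerreTwistCharts`.

What is NOT here: `𝒪(m)` for `m > 0` as a module (use `𝓗om(𝒪(-m), –)`), the tensor identities
`𝒪(-a) ⊗ 𝒪(-b) ≅ 𝒪(-a-b)`, the comparison with Mathlib pull-back of a twisting sheaf on `Proj`
(Mathlib, this pin, has no twisting sheaves: searched `twisting`, `Proj.*twist`, `Serre` in
`Mathlib/AlgebraicGeometry`: nothing).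

## References

* R. Hartshorne, *Algebraic Geometry*, GTM 52 (1977): II.5, Prop. 5.12 and Def. p. 117 (`𝒪_X(n)`),
  II Prop. 2.5 (the charts `D₊(x_j)`). [Hartshorne1977]
* A. Grothendieck, J. Dieudonné, EGA II (Publ. Math. IHÉS 8, 1961), §2.5 (faisceau `𝒪_X(n)`).
* J.-P. Serre, *Faisceaux algébriques cohérents*, Ann. of Math. 61 (1955), nᵒ 54 (`𝒪(n)` by
  transition functions `(x_i/x_j)^n`). [Serre1955FAC]
-/

noncomputable section

universe u

open CategoryTheory AlgebraicGeometry TopologicalSpace Opposite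
open Literature.Algebra.Homology Literature.Algebra.Homology.LaurentCech
open Literature.AlgebraicGeometry.Morphisms Literature.AlgebraicGeometry.Morphisms.ProjCech

attribute [local instance] MvPolynomial.gradedAlgebra
  Literature.AlgebraicGeometry.Motives.ProjBaseChange.algebraBase

namespace Literature.AlgebraicGeometry.Modules

/-! ## The product module `𝒪_X^I` -/

section Pi

variable (X : Scheme.{u}) (I : Type)

/-- The presheaf of abelian groups `U ↦ (I → Γ(X, U))` with componentwise restriction. [folklore] -/
def piPresheafAb : TopCat.Presheaf Ab X where
  obj U := AddCommGrpCat.of (I → Γ(X, U.unop))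
  map i := AddCommGrpCat.ofHom
    { toFun := fun f j => X.presheaf.map i (f j)
      map_zero' := funext fun _ => map_zero _
      map_add' := fun f g => funext fun j => map_add _ (f j) (g j) }
  map_id U := by
    refine AddCommGrpCat.ext fun f => funext fun j => ?_
    change X.presheaf.map (𝟙 U) (f j) = f j
    rw [X.presheaf.map_id]; rfl
  map_comp i i' := by
    refine AddCommGrpCat.ext fun f => funext fun j => ?_
    change X.presheaf.map (i ≫ i') (f j) = X.presheaf.map i' (X.presheaf.map i (f j))
    rw [X.presheaf.map_comp]; rfl

/-- Componentwise restriction, unfolded. [folklore] -/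
@[simp]
theorem piPresheafAb_map_apply {U V : (X.Opens)ᵒᵖ} (i : U ⟶ V) (f : I → Γ(X, U.unop)) (j : I) :
    (piPresheafAb X I).map i f j = X.presheaf.map i (f j) := rfl

/-- The presheaf of `𝒪_X`-modules `U ↦ (I → Γ(X, U))` (componentwise `𝒪_X(U)`-action). [folklore] -/
def piPresheaf : X.PresheafOfModules :=
  @PresheafOfModules.ofPresheaf _ _ X.ringCatSheaf.obj (piPresheafAb X I)
    (fun U => inferInstanceAs (Module Γ(X, U.unop) (I → Γ(X, U.unop))))
    (fun U _ i a f => funext fun j => by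
      change X.presheaf.map i ((show Γ(X, U.unop) from a) * f j) =
        X.presheaf.map i a * X.presheaf.map i (f j)
      exact map_mul _ _ _)

/-- The underlying abelian presheaf of `piPresheaf`. [folklore] -/
@[simp]
theorem piPresheaf_presheaf : (piPresheaf X I).presheaf = piPresheafAb X I := rfl

/-- **`U ↦ (I → Γ(X, U))` is a sheaf** (componentwise gluing in the structure sheaf). [folklore] -/
theorem isSheaf_piPresheaf : TopCat.Presheaf.IsSheaf (piPresheaf X I).presheaf := by
  rw [piPresheaf_presheaf, TopCat.Presheaf.isSheaf_iff_isSheafUniqueGluing]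
  intro κ U sf hsf
  have hsf' : ∀ j : I, TopCat.Presheaf.IsCompatible X.sheaf.1 U fun a => sf a j := fun j a b =>
    congrFun (hsf a b) j
  have H := fun j => X.sheaf.existsUnique_gluing U (fun a => sf a j) (hsf' j)
  refine ⟨fun j => (H j).exists.choose, fun a => funext fun j => (H j).exists.choose_spec a,
    fun t ht => funext fun j => (H j).unique ?_ (H j).exists.choose_spec⟩
  exact fun a => congrFun (ht a) j

/-- **The product module `𝒪_X^I`** as a sheaf of `𝒪_X`-modules: sections over `U` are the families
`I → Γ(X, U)`, definitionally. [folklore] -/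
def piModule : X.Modules where
  val := piPresheaf X I
  isSheaf := isSheaf_piPresheaf X I

variable {X I}

/-- Restriction in `𝒪_X^I` is componentwise: definitionally. [folklore] -/
theorem piModule_map_apply {U V : X.Opens} (h : V ≤ U) (f : Γ(piModule X I, U)) (j : I) :
    ((piModule X I).presheaf.map (homOfLE h).op f) j = X.presheaf.map (homOfLE h).op (f j) := rfl

/-- The `𝒪_X(U)`-action on `𝒪_X^I(U)` is componentwise: definitionally. [folklore] -/
theorem piModule_smul_apply {U : X.Opens} (a : Γ(X, U)) (f : Γ(piModule X I, U)) (j : I) :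
    (a • f) j = a * f j := rfl

end Pi

/-! ## Chart functions on a scheme over `𝐏ʳ_A` -/

namespace SerreTwist

variable {A : Type u} [CommRing A] {r : ℕ} {Z : Scheme.{u}} (ι : Z ⟶ PP A r)

/-- The chart function `x_i / x_j ∈ Γ(Z, Z_j)` on `Z_j = ι⁻¹ D₊(x_j)`: the degree-zero fraction
`t_{{i},j} = x_i / x_j` (`LaurentCech.tElB A {i} j`) evaluated on `Z` (`ProjCech.evalRing`).
For `i = j` it is `1`. [folklore] -/
def chartFun (i j : Fin (r + 1)) : Γ(Z, Zop ι {j}) :=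
  show Sections (strZ ι) (Zop ι {j}) from evalRing ι {j} (tElB A {i} j)

/-- The chart function of a WORD `w : Fin m → Fin (r+1)` on `Z_j`: `μ_w / x_j^m = Π_t (x_{w t} / x_j)`,
the `w`-component of the local generator of `𝒪_Z(-m)` on `Z_j`. [folklore] -/
def wordFun (j : Fin (r + 1)) {m : ℕ} (w : Fin m → Fin (r + 1)) : Γ(Z, Zop ι {j}) :=
  ∏ t, chartFun ι (w t) j

/-- The empty word has chart function `1`. [folklore] -/
@[simp]
theorem wordFun_zero (j : Fin (r + 1)) (w : Fin 0 → Fin (r + 1)) : wordFun ι j w = 1 :=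
  Finset.prod_of_isEmpty _

/-- `μ_{l :: w} / x_j^{m+1} = (x_l / x_j) · (μ_w / x_j^m)`. [folklore] -/
theorem wordFun_cons (j : Fin (r + 1)) {m : ℕ} (l : Fin (r + 1)) (w : Fin m → Fin (r + 1)) :
    wordFun ι j (Fin.cons l w : Fin (m + 1) → Fin (r + 1)) = chartFun ι l j * wordFun ι j w := by
  rw [wordFun, Fin.prod_univ_succ]
  simp only [Fin.cons_zero, Fin.cons_succ]
  rfl

/-- In the Laurent ring, `t_{{i},j} = x_i · x_j⁻¹` (for `i = j` both sides are `1`). [folklore] -/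
theorem tEl_singleton (i j : Fin (r + 1)) : tEl A ({i} : Finset (Fin (r + 1))) j = xs A {i} 1 * xs A {j} (-1) := by
  by_cases h : i = j
  · subst h
    rw [tEl, Finset.erase_singleton, Finset.card_empty, Nat.cast_zero, neg_zero, xs_zero, mul_one,
      xs_mul_xs_neg, Xs, Finset.prod_empty, map_one]
  · rw [tEl, Finset.erase_eq_of_notMem (Finset.notMem_singleton.mpr (Ne.symm h)), Finset.card_singleton,
      Nat.cast_one, ← pow_one (Xs A ({i} : Finset (Fin (r + 1)))), toL_Xs_pow, Nat.cast_one]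

/-- `x_j / x_j = 1` on `Z_j`. [folklore] -/
@[simp]
theorem chartFun_self (j : Fin (r + 1)) : chartFun ι j j = 1 := by
  have h : tElB A ({j} : Finset (Fin (r + 1))) j = 1 :=
    Subtype.ext ((tEl_singleton j j).trans (xs_mul_xs_neg (A := A) {j} 1))
  change evalRing ι {j} (tElB A {j} j) = 1
  rw [h, map_one]

/-- The constant word `j j ⋯ j` has chart function `1` on `Z_j` (`x_j^m / x_j^m = 1`). [folklore] -/
@[simp]
theorem wordFun_const (j : Fin (r + 1)) (m : ℕ) : wordFun ι j (fun _ : Fin m => j) = 1 := by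
  rw [wordFun]
  exact Finset.prod_eq_one fun _ _ => chartFun_self ι j

/-! ## The defining relation and the subsheaf `𝒪_Z(-m)` -/

variable {ι}

/-- The defining relation of `𝒪_Z(-m)` for a family `f : W_m → Γ(Z, U)`: on every chart `Z_j`,
`f_w · (μ_{w'} / x_j^m) = f_{w'} · (μ_w / x_j^m)` for all words `w, w'`, as functions on every open
`V ⊆ U ∩ Z_j` (stated for all such `V`, which is equivalent to `V = U ∩ Z_j` and handier).
[folklore] -/
def IsTwistSection (ι : Z ⟶ PP A r) (m : ℕ) (U : Z.Opens) (f : (Fin m → Fin (r + 1)) → Γ(Z, U)) : Prop :=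
  ∀ (j : Fin (r + 1)) (w w' : Fin m → Fin (r + 1)) ⦃V : Z.Opens⦄ (hV : V ≤ U) (hj : V ≤ Zop ι {j}),
    Z.presheaf.map (homOfLE hV).op (f w) * Z.presheaf.map (homOfLE hj).op (wordFun ι j w') =
      Z.presheaf.map (homOfLE hV).op (f w') * Z.presheaf.map (homOfLE hj).op (wordFun ι j w)

namespace IsTwistSection

variable {m : ℕ} {U : Z.Opens}

/-- `0` is a twist section. [folklore] -/
theorem zero : IsTwistSection ι m U 0 := fun j w w' V hV hj => by
  simp only [Pi.zero_apply, map_zero, zero_mul]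

/-- Twist sections are stable under addition. [folklore] -/
theorem add {f g : (Fin m → Fin (r + 1)) → Γ(Z, U)} (hf : IsTwistSection ι m U f)
    (hg : IsTwistSection ι m U g) : IsTwistSection ι m U (f + g) := fun j w w' V hV hj => by
  simp only [Pi.add_apply, map_add, add_mul]
  rw [hf j w w' hV hj, hg j w w' hV hj]

/-- Twist sections are stable under the `𝒪_Z(U)`-action. [folklore] -/
theorem smul (a : Γ(Z, U)) {f : (Fin m → Fin (r + 1)) → Γ(Z, U)} (hf : IsTwistSection ι m U f) :
    IsTwistSection ι m U (a • f) := fun j w w' V hV hj => by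
  simp only [Pi.smul_apply, smul_eq_mul, map_mul, mul_assoc]
  rw [hf j w w' hV hj]

/-- Restriction composed: `(f|_V)|_{V'} = f|_{V'}`. [folklore] -/
theorem map_map_apply {U V V' : Z.Opens} (h : V ≤ U) (h' : V' ≤ V) (s : Γ(Z, U)) :
    Z.presheaf.map (homOfLE h').op (Z.presheaf.map (homOfLE h).op s) =
      Z.presheaf.map (homOfLE (h'.trans h)).op s := by
  rw [← CategoryTheory.comp_apply, ← Functor.map_comp]
  rfl

/-- Twist sections restrict to twist sections. [folklore] -/
theorem map {f : (Fin m → Fin (r + 1)) → Γ(Z, U)} (hf : IsTwistSection ι m U f) {V : Z.Opens}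
    (h : V ≤ U) : IsTwistSection ι m V fun w => Z.presheaf.map (homOfLE h).op (f w) := by
  intro j w w' V' hV' hj
  rw [map_map_apply, map_map_apply]
  exact hf j w w' (hV'.trans h) hj

/-- **Local description on a chart**: on `V ⊆ U ∩ Z_j` every component is the `j j ⋯ j`-component
times the chart function, `f_w = f_{j⋯j} · (μ_w / x_j^m)`. [folklore] -/
theorem apply_eq_mul_wordFun {f : (Fin m → Fin (r + 1)) → Γ(Z, U)} (hf : IsTwistSection ι m U f)
    {V : Z.Opens} (hV : V ≤ U) {j : Fin (r + 1)} (hj : V ≤ Zop ι {j}) (w : Fin m → Fin (r + 1)) :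
    Z.presheaf.map (homOfLE hV).op (f w) =
      Z.presheaf.map (homOfLE hV).op (f fun _ => j) * Z.presheaf.map (homOfLE hj).op (wordFun ι j w) := by
  have key := hf j w (fun _ => j) hV hj
  rwa [wordFun_const, map_one, mul_one] at key

/-- Prefixing a letter: if `f` is a twist section of length `m + 1` then `w ↦ f (l :: w)` is a twist
section of length `m` (multiplication by `x_l`, cf. `SerreTwist.mulX`). [folklore] -/
theorem cons {f : (Fin (m + 1) → Fin (r + 1)) → Γ(Z, U)} (hf : IsTwistSection ι (m + 1) U f)
    (l : Fin (r + 1)) : IsTwistSection ι m U fun w => f (Fin.cons l w) := by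
  intro j w w' V hV hj
  rw [hf.apply_eq_mul_wordFun hV hj (Fin.cons l w), hf.apply_eq_mul_wordFun hV hj (Fin.cons l w'),
    wordFun_cons, wordFun_cons, map_mul, map_mul]
  ring

end IsTwistSection

variable (ι)

/-- The twist sections over `U` form an `𝒪_Z(U)`-submodule of `𝒪_Z^{W_m}(U)`. [folklore] -/
def twistSubmoduleObj (m : ℕ) (U : Z.Opens) :
    Submodule Γ(Z, U) Γ(piModule Z (Fin m → Fin (r + 1)), U) where
  carrier := {f | IsTwistSection ι m U f}
  zero_mem' := IsTwistSection.zero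
  add_mem' := IsTwistSection.add
  smul_mem' := fun a _ hf => IsTwistSection.smul a hf

/-- Membership in `twistSubmoduleObj`. [folklore] -/
theorem mem_twistSubmoduleObj_iff {m : ℕ} {U : Z.Opens} (f : Γ(piModule Z (Fin m → Fin (r + 1)), U)) :
    f ∈ twistSubmoduleObj ι m U ↔ IsTwistSection ι m U f := Iff.rfl

/-- **The family `U ↦ 𝒪_Z(-m)(U)` is stable under restriction**: a subobject of `𝒪_Z^{W_m}` in
presheaves of modules. [folklore] -/
def twistSubmodule (m : ℕ) : PresheafOfModules.Submodule (piModule Z (Fin m → Fin (r + 1))).val where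
  obj U := twistSubmoduleObj ι m U.unop
  map {U V} g := fun f hf => by
    change IsTwistSection ι m V.unop fun w => Z.presheaf.map g (f w)
    have e : g = (homOfLE g.unop.le).op := Subsingleton.elim _ _
    rw [e]
    exact IsTwistSection.map hf g.unop.le

/-- A family over `⨆ U_a` which is a twist section on every `U_a` is a twist section (the relation is
an equality of functions on `V ⊆ U ∩ Z_j`, checked on the cover `V ∩ U_a`). [folklore] -/
theorem isTwistSection_of_locally {m : ℕ} {κ : Type u} (U : κ → Z.Opens)
    (f : (Fin m → Fin (r + 1)) → Γ(Z, iSup U))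
    (hf : ∀ a, IsTwistSection ι m (U a) fun w => Z.presheaf.map (homOfLE (le_iSup U a)).op (f w)) :
    IsTwistSection ι m (iSup U) f := by
  intro j w w' V hV hj
  have hcov : V ≤ ⨆ a, V ⊓ U a := by
    rw [← inf_iSup_eq]
    exact le_inf le_rfl hV
  apply TopCat.Sheaf.eq_of_locally_eq' Z.sheaf (fun a => V ⊓ U a) V (fun a => homOfLE inf_le_left) hcov
  intro a
  change Z.presheaf.map _ (_ * _) = Z.presheaf.map _ (_ * _)
  rw [map_mul, map_mul, IsTwistSection.map_map_apply, IsTwistSection.map_map_apply,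
    IsTwistSection.map_map_apply, IsTwistSection.map_map_apply]
  have key := hf a j w w' (V := V ⊓ U a) inf_le_right (inf_le_left.trans hj)
  rw [IsTwistSection.map_map_apply, IsTwistSection.map_map_apply] at key
  exact key

/-- **`U ↦ 𝒪_Z(-m)(U)` is a sheaf.** [folklore] -/
theorem isSheaf_twistSubmodule (m : ℕ) :
    TopCat.Presheaf.IsSheaf (twistSubmodule ι m).toPresheafOfModules.presheaf := by
  rw [TopCat.Presheaf.isSheaf_iff_isSheafUniqueGluing]
  intro κ U sf hsf
  let M := piModule Z (Fin m → Fin (r + 1))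
  have hsf' : TopCat.Presheaf.IsCompatible M.presheaf U fun a => (sf a).val := fun a b =>
    congrArg Subtype.val (hsf a b)
  obtain ⟨s, hs, huniq⟩ := M.isSheaf.isSheafUniqueGluing U (fun a => (sf a).val) hsf'
  have hstw : IsTwistSection ι m (iSup U) s :=
    isTwistSection_of_locally ι U s fun a => by
      have e : (homOfLE (le_iSup U a)).op = (Opens.leSupr U a).op := Subsingleton.elim _ _
      have hsa := hs a
      rw [← e] at hsa
      have : (fun w => Z.presheaf.map (homOfLE (le_iSup U a)).op (s w)) = (sf a).val :=
        hsa
      rw [this]; exact (sf a).2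
  refine ⟨⟨s, hstw⟩, fun a => Subtype.ext (hs a), fun t ht => Subtype.ext (huniq t.val fun a => ?_)⟩
  exact congrArg Subtype.val (ht a)

/-- **Serre's twisting sheaf `𝒪_Z(-m) = ι^* 𝒪_𝐏(-m)`** of a scheme `ι : Z → 𝐏ʳ_A` over projective
space, as a sheaf of `𝒪_Z`-modules: the families `(f_w)_{w ∈ W_m}` of functions proportional on each
chart `Z_j` to `(μ_w / x_j^m)_w` (Hartshorne II.5, `𝒪(n)` for `n = -m ≤ 0`; Serre FAC nᵒ 54).
[cite: Hartshorne1977, II.5 Def. p. 117 and Prop. 5.12] -/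
def serreTwist (m : ℕ) : Z.Modules :=
  ⟨(twistSubmodule ι m).toPresheafOfModules, isSheaf_twistSubmodule ι m⟩

/-- The inclusion `𝒪_Z(-m) ⟶ 𝒪_Z^{W_m}`. [folklore] -/
def serreTwistι (m : ℕ) : serreTwist ι m ⟶ piModule Z (Fin m → Fin (r + 1)) :=
  ⟨(twistSubmodule ι m).ι⟩

/-- The components `f_w ∈ Γ(Z, U)` of a section `f` of `𝒪_Z(-m)` over `U`. [folklore] -/
def coeff {m : ℕ} {U : Z.Opens} (f : Γ(serreTwist ι m, U)) (w : Fin m → Fin (r + 1)) : Γ(Z, U) :=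
  (f : twistSubmoduleObj ι m U).val w

/-- The inclusion into `𝒪_Z^{W_m}` is the family of components: definitionally. [folklore] -/
theorem serreTwistι_app_apply {m : ℕ} (U : Z.Opens) (f : Γ(serreTwist ι m, U)) :
    (serreTwistι ι m).app U f = coeff ι f := rfl

/-- Sections of `𝒪_Z(-m)` satisfy the defining relation. [folklore] -/
theorem isTwistSection_coeff {m : ℕ} {U : Z.Opens} (f : Γ(serreTwist ι m, U)) :
    IsTwistSection ι m U (coeff ι f) := (f : twistSubmoduleObj ι m U).2

/-- Two sections of `𝒪_Z(-m)` with the same components are equal. [folklore] -/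
@[ext]
theorem ext {m : ℕ} {U : Z.Opens} {f g : Γ(serreTwist ι m, U)} (h : ∀ w, coeff ι f w = coeff ι g w) :
    f = g := Subtype.ext (funext h)

/-- A family satisfying the defining relation is a section of `𝒪_Z(-m)`. [folklore] -/
def mkSection {m : ℕ} {U : Z.Opens} (f : (Fin m → Fin (r + 1)) → Γ(Z, U)) (hf : IsTwistSection ι m U f) :
    Γ(serreTwist ι m, U) :=
  (⟨f, hf⟩ : twistSubmoduleObj ι m U)

/-- Components of `mkSection`: definitionally. [folklore] -/
@[simp]
theorem coeff_mkSection {m : ℕ} {U : Z.Opens} (f : (Fin m → Fin (r + 1)) → Γ(Z, U))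
    (hf : IsTwistSection ι m U f) (w : Fin m → Fin (r + 1)) : coeff ι (mkSection ι f hf) w = f w := rfl

/-- Restriction in `𝒪_Z(-m)` is componentwise. [folklore] -/
@[simp]
theorem coeff_map {m : ℕ} {U V : Z.Opens} (h : V ≤ U) (f : Γ(serreTwist ι m, U)) (w : Fin m → Fin (r + 1)) :
    coeff ι ((serreTwist ι m).presheaf.map (homOfLE h).op f) w = Z.presheaf.map (homOfLE h).op (coeff ι f w) :=
  rfl

/-- The `𝒪_Z(U)`-action on `𝒪_Z(-m)(U)` is componentwise. [folklore] -/
@[simp]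
theorem coeff_smul {m : ℕ} {U : Z.Opens} (a : Γ(Z, U)) (f : Γ(serreTwist ι m, U)) (w : Fin m → Fin (r + 1)) :
    coeff ι (a • f) w = a * coeff ι f w := rfl

/-- Components are additive. [folklore] -/
@[simp]
theorem coeff_add {m : ℕ} {U : Z.Opens} (f g : Γ(serreTwist ι m, U)) (w : Fin m → Fin (r + 1)) :
    coeff ι (f + g) w = coeff ι f w + coeff ι g w := rfl

/-- Components of zero. [folklore] -/
@[simp]
theorem coeff_zero {m : ℕ} {U : Z.Opens} (w : Fin m → Fin (r + 1)) :
    coeff ι (0 : Γ(serreTwist ι m, U)) w = 0 := rfl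

/-! ## Multiplication by a variable `x_l : 𝒪_Z(-(m+1)) → 𝒪_Z(-m)` -/

/-- **Multiplication by the variable `x_l`** (the global section `x_l` of `𝒪_𝐏(1)`):
`𝒪_Z(-(m+1)) ⟶ 𝒪_Z(-m)`, `f ↦ (w ↦ f (l :: w))`; on the chart `Z_j` it multiplies the coordinate by
`x_l / x_j`. [folklore] -/
def mulX (m : ℕ) (l : Fin (r + 1)) : serreTwist ι (m + 1) ⟶ serreTwist ι m where
  val := PresheafOfModules.homMk
    { app := fun _ => AddCommGrpCat.ofHom
        { toFun := fun f => mkSection ι (fun w => coeff ι f (Fin.cons l w)) ((isTwistSection_coeff ι f).cons l)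
          map_zero' := rfl
          map_add' := fun _ _ => rfl }
      naturality := fun _ _ _ => rfl }
    (fun _ _ _ => rfl)

/-- Components of `x_l · f`: definitionally `f_{l :: w}`. [folklore] -/
@[simp]
theorem coeff_mulX_app {m : ℕ} (l : Fin (r + 1)) (U : Z.Opens) (f : Γ(serreTwist ι (m + 1), U))
    (w : Fin m → Fin (r + 1)) : coeff ι ((mulX ι m l).app U f) w = coeff ι f (Fin.cons l w) := rfl

end SerreTwist

end Literature.AlgebraicGeometry.Modules

end
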